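import Literature.Probability.LatticeModels.SahiThirdOrderCorrelation
import Literature.Combinatorics.Sahi2008.ProvedCases
import Summits.CriticalPhenomena.PercolationContinuityZ3.Theorems.PercNearOneGluingNoHeavyLowerTailSahiE3CovHit

/-!
# `E₃` on the containing stratum is an explicit nonnegative combination (order 3, every weight)

Support file (literature seat `prim-sahi-lit`, generation 48; `--supports stmt-CriticalPhenomena-4575`).  Pure proofs,
no definitions, no `sorry`, standard axioms.

The lane `prim-masterthm-p3` (gen 18) proved that Sahi's `E₃(1_A, 1_B, 1_C) ≥ 0` for every FKG weight as soon as one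
member contains the intersection of the other two (`SahiAbsorbed.sahiE_three_setInd_nonneg_of_inter_subset`,
`SahiAbsorbed.kahn_sahiE3_nonneg_of_inter_subset`), through the every-order machinery (multilinearity in the head,
Sahi's branching identity, and the value-level sign law — the latter is Lieb–Sahi's `A(n)`, [LiebSahi2021, Thm. 3.11],
for every weight).  At order `3` the same three steps collapse to a CLOSED FORM, valid for EVERY real weight `μ` and
ALL finite sets `A, B, C` with `B ∩ C ⊆ A` (no monotonicity, no sign, no normalisation), in the homogeneous functional
`latticeE3` (`= Z³·E₃`, `Z = μ(univ)`):

  `latticeE3 μ A B C = (2Z − μ(A))·(Z·μ(B∩C) − μ(B)μ(C)) + Z·(μ(B)·μ(C ∖ (A∪B)) + μ(C)·μ(B ∖ (A∪C)))`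
                                                                            (`latticeE3_eq_of_inter_subset`).

Consequences (`μ ≥ 0` log-supermodular on a finite distributive lattice, `B, C` up-sets, `A ⊇ B ∩ C` ARBITRARY — not
necessarily increasing): `Z·(Z·μ(B∩C) − μ(B)μ(C)) ≤ latticeE3 μ A B C` (`covTerm_le_latticeE3_of_inter_subset`: `E₃` is at
least the FKG covariance of the two other members), hence `0 ≤ latticeE3 μ A B C` (`latticeE3_nonneg_of_inter_subset`); for a
probability weight, `cov(1_B, 1_C) ≤ E₃(1_A, 1_B, 1_C)` and `0 ≤ E₃(1_A, 1_B, 1_C)` in Sahi's normalisation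
(`sahiE_three_setInd_ge_cov_of_inter_subset`, `sahiE_three_setInd_nonneg_of_inter_subset'`).  Only the ORDER-2
inequality (FKG/Harris for `B, C`) is used. [this work]

Landing note (prover seat `prim-nh-dp-fatminority`, gen 267): landed verbatim from the literature seat's staged file
(sha256 `ff3b6746…`), except that the local copy of the folklore additivity lemma `mass_union_of_disjoint` was removed in
favour of the already-landed `SahiE3CovHit.mass_union_of_disjoint` (gate rule `dedup.landed`; one import added, one
reference requalified); every other declaration is byte-identical.
-/

namespace Summit.CriticalPhenomena.PercolationContinuityZ3.Theorems

open Finset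
open Literature.Probability.LatticeModels (mass mass_nonneg mass_mono mass_univ latticeE3 fkg_upperSet_mass)
open Literature.Combinatorics.Sahi2008 (sahiE setInd ex ex_setInd sahiE_three_indicator_eq_latticeE3 IsFKGMeasure)

namespace SahiE3Containing

variable {α : Type*} [Fintype α] [DecidableEq α]

omit [Fintype α] in
/-- If `B ∩ C ⊆ A` then `μ(B) = μ(A ∩ B) + μ(B ∖ (A ∪ C))`: a point of `B` outside `A` is outside `C`. [this work] -/
theorem mass_eq_inter_add_sdiff (μ : α → ℝ) {A B C : Finset α} (h : B ∩ C ⊆ A) :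
    mass μ B = mass μ (A ∩ B) + mass μ (B \ (A ∪ C)) := by
  rw [← SahiE3CovHit.mass_union_of_disjoint μ]
  · congr 1
    ext x
    simp only [mem_union, mem_inter, mem_sdiff]
    constructor
    · intro hx
      by_cases hA : x ∈ A
      · exact Or.inl ⟨hA, hx⟩
      · refine Or.inr ⟨hx, ?_⟩
        rintro (hA' | hC)
        · exact hA hA'
        · exact hA (h (mem_inter.2 ⟨hx, hC⟩))
    · rintro (⟨-, hx⟩ | ⟨hx, -⟩) <;> exact hx
  · rw [Finset.disjoint_left]
    rintro x hx hx'
    rw [mem_inter] at hx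
    rw [mem_sdiff, mem_union] at hx'
    exact hx'.2 (Or.inl hx.1)

/-- **The closed form on the containing stratum (every real weight, all finite sets with `B ∩ C ⊆ A`).**
`latticeE3 μ A B C = (2Z − μA)(Z·μ(B∩C) − μB·μC) + Z·(μB·μ(C∖(A∪B)) + μC·μ(B∖(A∪C)))`, `Z = μ(univ)`. [this work] -/
theorem latticeE3_eq_of_inter_subset (μ : α → ℝ) {A B C : Finset α} (h : B ∩ C ⊆ A) :
    latticeE3 μ A B C =
      (2 * mass μ univ - mass μ A) * (mass μ univ * mass μ (B ∩ C) - mass μ B * mass μ C) +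
        mass μ univ * (mass μ B * mass μ (C \ (A ∪ B)) + mass μ C * mass μ (B \ (A ∪ C))) := by
  have hABC : A ∩ B ∩ C = B ∩ C := by
    ext x
    simp only [mem_inter]
    constructor
    · rintro ⟨⟨-, hB⟩, hC⟩; exact ⟨hB, hC⟩
    · rintro ⟨hB, hC⟩; exact ⟨⟨h (mem_inter.2 ⟨hB, hC⟩), hB⟩, hC⟩
  have hB := mass_eq_inter_add_sdiff μ h
  have hC : mass μ C = mass μ (A ∩ C) + mass μ (C \ (A ∪ B)) :=
    mass_eq_inter_add_sdiff μ (show C ∩ B ⊆ A by rwa [inter_comm])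
  unfold latticeE3
  rw [hABC]
  linear_combination (mass μ univ * mass μ C) * hB + (mass μ univ * mass μ B) * hC

/-- **`E₃` dominates the covariance of the two other members** (homogeneous form): for a nonnegative log-supermodular
weight on a finite distributive lattice, up-sets `B, C` and ANY finite set `A ⊇ B ∩ C`,
`Z·(Z·μ(B∩C) − μB·μC) ≤ latticeE3 μ A B C`. [this work] -/
theorem covTerm_le_latticeE3_of_inter_subset [DistribLattice α] {μ : α → ℝ} (hμ₀ : 0 ≤ μ)
    (hμ : ∀ a b, μ a * μ b ≤ μ (a ⊓ b) * μ (a ⊔ b)) {A B C : Finset α} (h : B ∩ C ⊆ A)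
    (hB : IsUpperSet (B : Set α)) (hC : IsUpperSet (C : Set α)) :
    mass μ univ * (mass μ univ * mass μ (B ∩ C) - mass μ B * mass μ C) ≤ latticeE3 μ A B C := by
  rw [latticeE3_eq_of_inter_subset μ h]
  have hcov : 0 ≤ mass μ univ * mass μ (B ∩ C) - mass μ B * mass μ C :=
    sub_nonneg.2 (fkg_upperSet_mass hμ₀ hμ hB hC)
  have hZ := mass_nonneg hμ₀ (univ : Finset α)
  have hA : mass μ A ≤ mass μ univ := mass_mono hμ₀ (subset_univ A)
  have hb := mass_nonneg hμ₀ B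
  have hc := mass_nonneg hμ₀ C
  have h1 := mass_nonneg hμ₀ (C \ (A ∪ B))
  have h2 := mass_nonneg hμ₀ (B \ (A ∪ C))
  nlinarith [mul_nonneg hb h1, mul_nonneg hc h2, mul_nonneg (sub_nonneg.2 hA) hcov]

/-- **`E₃ ≥ 0` on the containing stratum** (homogeneous form), `A ⊇ B ∩ C` arbitrary, `B, C` up-sets, `μ ≥ 0`
log-supermodular. [this work] -/
theorem latticeE3_nonneg_of_inter_subset [DistribLattice α] {μ : α → ℝ} (hμ₀ : 0 ≤ μ)
    (hμ : ∀ a b, μ a * μ b ≤ μ (a ⊓ b) * μ (a ⊔ b)) {A B C : Finset α} (h : B ∩ C ⊆ A)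
    (hB : IsUpperSet (B : Set α)) (hC : IsUpperSet (C : Set α)) : 0 ≤ latticeE3 μ A B C :=
  le_trans (mul_nonneg (mass_nonneg hμ₀ _) (sub_nonneg.2 (fkg_upperSet_mass hμ₀ hμ hB hC)))
    (covTerm_le_latticeE3_of_inter_subset hμ₀ hμ h hB hC)

/-- **Sahi's normalisation**: for an FKG probability weight, up-sets `B, C` and any finite `A ⊇ B ∩ C`,
`cov(1_B, 1_C) = μ(B∩C) − μ(B)μ(C) ≤ E₃(1_A, 1_B, 1_C)`. [this work] -/
theorem sahiE_three_setInd_ge_cov_of_inter_subset [DistribLattice α] {μ : α → ℝ} (hμ : IsFKGMeasure μ)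
    {A B C : Finset α} (h : B ∩ C ⊆ A) (hB : IsUpperSet (B : Set α)) (hC : IsUpperSet (C : Set α)) :
    mass μ (B ∩ C) - mass μ B * mass μ C ≤ sahiE μ 3 ![setInd A, setInd B, setInd C] := by
  rw [sahiE_three_indicator_eq_latticeE3 hμ.sum_eq_one]
  have key := covTerm_le_latticeE3_of_inter_subset hμ.nonneg hμ.mul_le_mul h hB hC
  have hZ : mass μ (univ : Finset α) = 1 := by rw [mass_univ]; exact hμ.sum_eq_one
  rw [hZ] at key
  linarith

/-- **`E₃(1_A, 1_B, 1_C) ≥ 0`** for an FKG probability weight, up-sets `B, C` and ANY finite `A ⊇ B ∩ C` (the head need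
not be increasing). [this work] -/
theorem sahiE_three_setInd_nonneg_of_inter_subset' [DistribLattice α] {μ : α → ℝ} (hμ : IsFKGMeasure μ)
    {A B C : Finset α} (h : B ∩ C ⊆ A) (hB : IsUpperSet (B : Set α)) (hC : IsUpperSet (C : Set α)) :
    0 ≤ sahiE μ 3 ![setInd A, setInd B, setInd C] :=
  le_trans (sub_nonneg.2 (by
    have := fkg_upperSet_mass hμ.nonneg hμ.mul_le_mul hB hC
    rw [mass_univ, hμ.sum_eq_one, one_mul] at this
    exact this)) (sahiE_three_setInd_ge_cov_of_inter_subset hμ h hB hC)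

end SahiE3Containing

end Summit.CriticalPhenomena.PercolationContinuityZ3.Theorems
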